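import Literature.AlgebraicGeometry.Resolution.KummerToricAlgebra
import Literature.AlgebraicGeometry.Resolution.KummerCone
import HarnessLib

/-!
# The Kummer chart `P → T` of the normalised Kummer cover

Topic: `Literature/AlgebraicGeometry/Resolution`. DEFINITION with basic API (all proved): the
monoid homomorphism from the Kummer cone `P = kummerCone p j₀ c ⊆ ℤʳ` (`KummerCone.lean`) to
the toric algebra `T` of the normalised Kummer cover `τ^p = x^c`, `c_{j₀} = 1`, inside the root
cover `B' = O[s]/(s^p - x)` (`KummerToricAlgebra.lean`):

  `v ↦ s^{p·m(v)} = τ^{v_{j₀}} · ∏_{j ≠ j₀} x_j^{v_j}`,  `τ = s_{j₀} ∏_{j ≠ j₀} s_j^{c_j}`,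

where `p·m(v) = kummerExp p j₀ c v ∈ ℕʳ` (K. Kato, *Toric singularities*, Amer. J. Math. 116
(1994), (2.2)(2): the chart of the log structure of the Kummer cover of an snc pair).

* `RootCover.rootMonomial e` (`s^e`, `e : Fin r → ℕ`), `rootMonomial_add`, `rootMonomial_single`
  (`s^{p e_j} = x_j`), `rootMonomial_eq_smul_boxMonomial`;
* `RootCover.natExp`, `RootCover.chart : Multiplicative P →* B'`, `chart_mem_toric`,
  `RootCover.toricChart : Multiplicative P →* T`, `chart_single` (`e_j ↦ x_j`),
  `chart_pivotGen` (`(p ; -c) ↦ x_{j₀}`).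

What is NOT here: Kato's ideal and face of the chart, log regularity
(`KummerChartLogRegular.lean`).

Sources: [Kato1994] K. Kato, Amer. J. Math. 116 (1994), (1.5), Def. (2.1), (2.2)(2).
-/

noncomputable section

namespace Literature.AlgebraicGeometry.Resolution

open MvPolynomial IsLocalRing

namespace RootCover

variable {O : Type*} [CommRing O] {r : ℕ} {p : ℕ} {x : Fin r → O}
variable {j₀ : Fin r} {c : Fin r → ℕ}

/-! ## Monomials in the roots indexed by `ℕʳ` -/

variable (p x) in
/-- The monomial `s^e = ∏ s_j^{e_j}` for an arbitrary exponent `e : Fin r → ℕ` (not reduced into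
the box). [cite: Kato1994, (2.2)(2)] -/
def rootMonomial (e : Fin r → ℕ) : RootCover p x := ∏ j, root p x j ^ e j

/-- `s^0 = 1`. [folklore] -/
@[simp] theorem rootMonomial_zero : rootMonomial p x 0 = 1 := by simp [rootMonomial]

/-- `s^{e + e'} = s^e s^{e'}`. [folklore] -/
theorem rootMonomial_add (e e' : Fin r → ℕ) :
    rootMonomial p x (e + e') = rootMonomial p x e * rootMonomial p x e' := by
  simp only [rootMonomial, Pi.add_apply, pow_add, Finset.prod_mul_distrib]

/-- `s^{p · e_j} = x_j`. [folklore] -/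
theorem rootMonomial_single (j : Fin r) :
    rootMonomial p x (Pi.single j p) = algebraMap O _ (x j) := by
  rw [rootMonomial, Finset.prod_eq_single j (fun i _ hij => by rw [Pi.single_eq_of_ne hij, pow_zero])
    (fun h => absurd (Finset.mem_univ j) h), Pi.single_eq_same, root_pow]

/-- The exponent `kummerExp v` of a cone element, as a vector of natural numbers. [folklore] -/
def natExp (p : ℕ) (j₀ : Fin r) (c : Fin r → ℕ) (v : kummerCone p j₀ c) : Fin r → ℕ :=
  fun j => (kummerExp p j₀ c v j).toNat

/-- `natExp` casts back to `kummerExp`. [folklore] -/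
theorem natExp_cast (v : kummerCone p j₀ c) (j : Fin r) :
    ((natExp p j₀ c v j : ℕ) : ℤ) = kummerExp p j₀ c v j :=
  Int.toNat_of_nonneg (v.2 j)

/-- `natExp` is additive. [folklore] -/
theorem natExp_add (v w : kummerCone p j₀ c) : natExp p j₀ c (v + w) = natExp p j₀ c v + natExp p j₀ c w := by
  ext j
  have := natExp_cast (v + w) j
  rw [AddSubmonoid.coe_add, map_add, Pi.add_apply, ← natExp_cast v j, ← natExp_cast w j] at this
  exact_mod_cast this

variable [hp : Fact p.Prime]

/-- Reduction into the box. [folklore] -/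
def modBox' (e : Fin r → ℕ) : Fin r → Fin p := fun j => ⟨e j % p, Nat.mod_lt _ hp.out.pos⟩

/-- `s^e = x^{e / p} · s^{e mod p}`. [folklore] -/
theorem rootMonomial_eq_smul_boxMonomial (e : Fin r → ℕ) :
    rootMonomial p x e = (∏ j, x j ^ (e j / p)) • boxMonomial p x (modBox' e) := by
  rw [rootMonomial, boxMonomial, Algebra.smul_def, map_prod, ← Finset.prod_mul_distrib]
  refine Finset.prod_congr rfl fun j _ => ?_
  rw [root_pow_eq j (e j), map_pow]
  rfl

/-- The coordinates of `s^e`: `x^{e/p}` at `e mod p`, zero elsewhere. [folklore] -/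
theorem coord_rootMonomial (e : Fin r → ℕ) :
    coord (rootMonomial p x e) = (∏ j, x j ^ (e j / p)) • Pi.single (modBox' e) (1 : O) := by
  rw [rootMonomial_eq_smul_boxMonomial, map_smul, coord_boxMonomial]

/-! ## The Kummer chart `P → T` -/

/-- `natExp` vanishes only at `0` (`kummerExp` is injective). [folklore] -/
theorem natExp_eq_zero_iff (v : kummerCone p j₀ c) : natExp p j₀ c v = 0 ↔ v = 0 := by
  constructor
  · intro h
    apply Subtype.ext
    apply kummerExp_injective hp.out.pos j₀ c
    rw [AddSubmonoid.coe_zero, map_zero]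
    ext j
    rw [← natExp_cast, h]
    rfl
  · rintro rfl
    ext j
    simp [natExp]

/-- The reduced exponent of a cone element is a Kummer exponent when `c_{j₀} = 1`. [folklore] -/
theorem isKummerExp_modBox'_natExp (hc : c j₀ = 1) (v : kummerCone p j₀ c) :
    IsKummerExp p j₀ c (modBox' (p := p) (natExp p j₀ c v)) := by
  intro j
  simp only [modBox', Fin.val_mk, ZMod.natCast_mod]
  have hj : ((natExp p j₀ c v j : ℕ) : ZMod p) = ((kummerExp p j₀ c v j : ℤ) : ZMod p) := by
    rw [← natExp_cast, Int.cast_natCast]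
  have hj₀ : ((natExp p j₀ c v j₀ : ℕ) : ZMod p) = ((kummerExp p j₀ c v j₀ : ℤ) : ZMod p) := by
    rw [← natExp_cast, Int.cast_natCast]
  rw [hj, hj₀, kummerExp_apply_self]
  by_cases h : j = j₀
  · subst h
    rw [kummerExp_apply_self, hc, Nat.cast_one, one_mul]
  · rw [kummerExp_apply_of_ne p c _ h]
    push_cast
    rw [ZMod.natCast_self, zero_mul, add_zero]

variable (p x j₀ c) in
/-- **The Kummer chart** `P → B'`, `v ↦ s^{p·m(v)} = τ^{v_{j₀}} ∏_{j ≠ j₀} x_j^{v_j}`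
(`τ = s_{j₀} ∏ s_j^{c_j}`), as a monoid homomorphism into the root cover.
[cite: Kato1994, (2.2)(2)] -/
def chart : Multiplicative (kummerCone p j₀ c) →* RootCover p x where
  toFun v := rootMonomial p x (natExp p j₀ c v.toAdd)
  map_one' := by
    change rootMonomial p x (natExp p j₀ c (0 : kummerCone p j₀ c)) = 1
    rw [(natExp_eq_zero_iff _).mpr rfl, rootMonomial_zero]
  map_mul' v w := by
    change rootMonomial p x (natExp p j₀ c (v.toAdd + w.toAdd)) = _
    rw [natExp_add, rootMonomial_add]

/-- Formula for the chart (`rfl`). [folklore] -/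
theorem chart_apply (v : Multiplicative (kummerCone p j₀ c)) :
    chart p x j₀ c v = rootMonomial p x (natExp p j₀ c v.toAdd) := rfl

/-- The chart lands in the toric algebra (`c_{j₀} = 1`). [cite: Kato1994, (2.2)(2)] -/
theorem chart_mem_toric (hc : c j₀ = 1) (v : Multiplicative (kummerCone p j₀ c)) :
    chart p x j₀ c v ∈ toric p x j₀ c := by
  rw [chart_apply, rootMonomial_eq_smul_boxMonomial]
  exact Subalgebra.smul_mem _ (boxMonomial_mem_toric (isKummerExp_modBox'_natExp hc _)) _

variable (p x j₀ c) in
/-- **The Kummer chart into the toric algebra** `P → T`. [cite: Kato1994, (2.2)(2)] -/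
def toricChart (hc : c j₀ = 1) : Multiplicative (kummerCone p j₀ c) →* toric p x j₀ c :=
  (chart p x j₀ c).codRestrict (toric p x j₀ c).toSubmonoid (chart_mem_toric hc)

/-- Underlying element of the toric chart (`rfl`). [folklore] -/
@[simp] theorem coe_toricChart (hc : c j₀ = 1) (v : Multiplicative (kummerCone p j₀ c)) :
    (toricChart p x j₀ c hc v : RootCover p x) = chart p x j₀ c v := rfl

/-- The unit vector `e_j`, `j ≠ j₀`, charts to `x_j`. [cite: Kato1994, (2.2)(2)] -/
theorem chart_single (j : Fin r) (hj : j ≠ j₀) :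
    chart p x j₀ c (Multiplicative.ofAdd ⟨Pi.single j 1, single_mem_kummerCone p j₀ c j 1⟩) =
      algebraMap O _ (x j) := by
  rw [chart_apply, ← rootMonomial_single j]
  congr 1
  ext i
  apply Int.ofNat.inj
  change ((natExp p j₀ c _ i : ℕ) : ℤ) = ((Pi.single j p : Fin r → ℕ) i : ℤ)
  rw [natExp_cast]
  change kummerExp p j₀ c (Pi.single j (1 : ℤ)) i = _
  have hj' : j₀ ≠ j := Ne.symm hj
  by_cases hi : i = j₀
  · subst hi
    rw [kummerExp_apply_self]
    simp [hj']
  · rw [kummerExp_apply_of_ne p c _ hi]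
    simp only [Pi.single_apply, if_neg hj', mul_zero, zero_add]
    by_cases hij : i = j <;> simp [hij]

/-- The relation vector `(p ; -c_j)` charts to `x_{j₀}`. [cite: Kato1994, (2.2)(2)] -/
theorem chart_pivotGen :
    chart p x j₀ c (Multiplicative.ofAdd ⟨pivotGen p j₀ c, pivotGen_mem_kummerCone p j₀ c⟩) =
      algebraMap O _ (x j₀) := by
  rw [chart_apply, ← rootMonomial_single j₀]
  congr 1
  ext i
  apply Int.ofNat.inj
  change ((natExp p j₀ c _ i : ℕ) : ℤ) = ((Pi.single j₀ p : Fin r → ℕ) i : ℤ)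
  rw [natExp_cast]
  change kummerExp p j₀ c (pivotGen p j₀ c) i = _
  rw [kummerExp_pivotGen]
  by_cases hi : i = j₀
  · subst hi; simp
  · rw [Pi.single_eq_of_ne hi, Pi.single_eq_of_ne hi]; rfl

end RootCover

end Literature.AlgebraicGeometry.Resolution

end
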